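import Mathlib
import Summits.NavierStokesRegularity.NavierStokesRegularity.Theorems.TaoLadderRungTwoBreakBlowupRigidityOneQuietShell
import HarnessLib

/-!
# Robust blow-up delivers the LOWER-PINNING clause of `WakeRatchet.MinimalViscousBlowup` (stmt-NavierStokesRegularity-22743)
  verbatim, at every small viscosity — by-name packaging of `everyShellLoud_of_noGlobalCascade` for the K2ᵛ extraction chain
  (support for K2(1) `TaoLadderRungTwoBreak.BlowupRigidityOne`, stmt-NavierStokesRegularity-20206, and ⟨20420⟩/⟨22743⟩)

MODEL lattice ODEs only (Tao 2016 §4, the viscous lattice before Thm. 4.2); nothing here is a statement about the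
Navier–Stokes equations; NO item is closed (`--supports stmt-NavierStokesRegularity-20206`). Route-independent (no `Theses`
import), general `m`, DEF-FREE.

`MinimalViscousBlowup` (route WakeRatchet, ⟨22743⟩, child of the shared consequence-crux K2ᵛ ⟨20420⟩) asks, below a threshold,
for `∃ (ν T C c : ℝ) X, 0 < ν ∧ 0 < T ∧ 0 < c ∧` [flow clauses] `∧` (i) type I `∧` (ii) per-shell action `∧` (iii) upper pinning
`(1+ε₀)^n ‖x_n(t)‖² ≤ C` `∧` (iv) lower pinning `∀ n : ℤ, 0 ≤ n → ∃ t, 0 ≤ t ∧ t < T ∧ c ≤ (1+ε₀)^n ‖x_n(t)‖²`. This module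
records that the flow clauses and (iv) — in exactly that shape (`n : ℤ`, `zpow`) — hold for EVERY viscosity `0 < ν ≤ κ/√2`
along the maximal `ν`-viscous flow of a robustly blowing-up table, with `c = (ν/(2(C_A+1)(1+ε₀)^9))²`, for every `ε₀ > 0`
(no threshold needed):
* `lowerPinning_of_noGlobalCascade` — the `∀ ν` form with the (4.5)-blow-up clause kept;
* `minimalViscousBlowup_clauses_iv_of_noGlobalCascade` — the `∃ ν T c X` packaging in the clause order of ⟨22743⟩ minus
  (i)–(iii). So a selection argument for ⟨22743⟩ need only produce (i) type I, (ii) the action bound and (iii) the upper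
  pinning at SOME viscosity in `(0, κ/√2]`; (iv) is automatic there.
HONEST LABEL: (i)–(iii) are open; no stub, crux or summit is proved; rung 0.
-/

noncomputable section

-- the summit and its single sub-problem share the name (CONVENTIONS §1)
set_option linter.dupNamespace false

open Set Filter Topology

namespace Summit.NavierStokesRegularity.NavierStokesRegularity.Theorems

namespace BlowupRigidityOne

open Literature.Analysis.FluidPDE Literature.Analysis.FluidPDE.TaoCascade

variable {m : ℕ}

/-- **LOWER PINNING (clause (iv) of ⟨22743⟩) FOR EVERY SMALL VISCOSITY.** If `NoGlobalCascade ε₀ α X₀` (`ε₀ > 0`, `α ∈ E₂(R)`,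
any `m`), there is `κ > 0` such that for every `0 < ν ≤ κ/√2` the maximal `ν`-viscous flow from the one-shell datum (datum, no
shells below `0`, viscous motion, (4.5) norm unbounded on `[0,T)`) satisfies, with `c = (ν/(2(C_A+1)(1+ε₀)^9))² > 0`:
`∀ n : ℤ, 0 ≤ n → ∃ t, 0 ≤ t ∧ t < T ∧ c ≤ (1+ε₀)^n ‖x_n(t)‖²`.
[cite: Tao2016AveragedNS, §4 Thm. 4.2 and the viscous equation before Thm. 4.2; Teschl2012, §2.6 Cor. 2.16] -/
theorem lowerPinning_of_noGlobalCascade {ε₀ R : ℝ} (hε : 0 < ε₀)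
    {α : Fin m → Fin m → Fin m → ℤ × ℤ × ℤ → ℝ} {X₀ : Fin m → ℝ} (hα : InTableClass R α)
    (hNG : NoGlobalCascade ε₀ α X₀) :
    ∃ κ : ℝ, 0 < κ ∧ ∀ ν : ℝ, 0 < ν → ν * Real.sqrt 2 ≤ κ →
      ∃ (T c : ℝ) (X : Fin m → ℤ → ℝ → ℝ), 0 < T ∧ 0 < c ∧
        (∀ i n, ContDiffOn ℝ 1 (X i n) (Set.Ico 0 T)) ∧
        (∀ i n, X i n 0 = if n = 0 then X₀ i else 0) ∧
        (∀ i n t, n < 0 → X i n t = 0) ∧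
        (∀ i n t, 0 ≤ t → t < T → derivWithin (X i n) (Set.Ici 0) t =
          quadTerm ε₀ α X i n t - ν * (1 + ε₀) ^ ((2 : ℝ) * n) * X i n t) ∧
        (∀ M : ℝ, ∃ t : ℝ, 0 ≤ t ∧ t < T ∧
          ∃ (i : Fin m) (n : ℤ), M < (1 + (1 + ε₀) ^ ((10 : ℝ) * n)) * |X i n t|) ∧
        (∀ n : ℤ, 0 ≤ n → ∃ t : ℝ, 0 ≤ t ∧ t < T ∧ c ≤ (1 + ε₀) ^ n * ‖shellVec X n t‖ ^ 2) := by
  obtain ⟨κ, hκ, H⟩ := everyShellLoud_of_noGlobalCascade hε hα hNG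
  refine ⟨κ, hκ, fun ν hν hνκ => ?_⟩
  obtain ⟨T, X, hT, h1, h2, h3, h4, -, h6, hloud⟩ := H ν hν hνκ
  have hb : (0 : ℝ) < 1 + ε₀ := by linarith
  have hC0 : 0 ≤ shiftConst α (0, 0, 1) := shiftConst_nonneg α _
  refine ⟨T, (ν / (2 * (shiftConst α (0, 0, 1) + 1) * (1 + ε₀) ^ 9)) ^ 2, X, hT, by positivity, h1, h2, h3, h4, h6,
    fun n hn => ?_⟩
  obtain ⟨k, rfl⟩ := Int.eq_ofNat_of_zero_le hn
  obtain ⟨t, ht0, htT, hlt⟩ := hloud k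
  exact ⟨t, ht0, htT, by rw [zpow_natCast]; exact hlt.le⟩

/-- **THE ⟨22743⟩ PACKAGE MINUS (i)–(iii), for every `ε₀ > 0`.** From `NoGlobalCascade ε₀ α X₀` (`α ∈ E₂(R)`): `∃ (ν T c : ℝ) X`
with `0 < ν`, `0 < T`, `0 < c`, the flow clauses of `WakeRatchet.MinimalViscousBlowup` (`C¹` on `[0,T)`, datum, no shells below
`0`, `ν`-viscous motion) and its lower-pinning clause (iv) verbatim. (The missing clauses are type I, the per-shell action
bound and the upper pinning — the open selection content of ⟨22743⟩.)
[cite: Tao2016AveragedNS, §4 Thm. 4.2 and the viscous equation before Thm. 4.2; Teschl2012, §2.6 Cor. 2.16] -/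
theorem minimalViscousBlowup_clauses_iv_of_noGlobalCascade {ε₀ R : ℝ} (hε : 0 < ε₀)
    {α : Fin m → Fin m → Fin m → ℤ × ℤ × ℤ → ℝ} {X₀ : Fin m → ℝ} (hα : InTableClass R α)
    (hNG : NoGlobalCascade ε₀ α X₀) :
    ∃ (ν T c : ℝ) (X : Fin m → ℤ → ℝ → ℝ), 0 < ν ∧ 0 < T ∧ 0 < c ∧
      (∀ i n, ContDiffOn ℝ 1 (X i n) (Set.Ico 0 T)) ∧
      (∀ i n, X i n 0 = if n = 0 then X₀ i else 0) ∧
      (∀ i n t, n < 0 → X i n t = 0) ∧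
      (∀ i n t, 0 ≤ t → t < T → derivWithin (X i n) (Set.Ici 0) t =
        quadTerm ε₀ α X i n t - ν * (1 + ε₀) ^ ((2 : ℝ) * n) * X i n t) ∧
      (∀ n : ℤ, 0 ≤ n → ∃ t : ℝ, 0 ≤ t ∧ t < T ∧ c ≤ (1 + ε₀) ^ n * ‖shellVec X n t‖ ^ 2) := by
  obtain ⟨κ, hκ, H⟩ := lowerPinning_of_noGlobalCascade hε hα hNG
  have hs2 : 0 < Real.sqrt 2 := Real.sqrt_pos.2 (by norm_num)
  -- the largest admissible viscosity `ν = κ/√2`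
  obtain ⟨T, c, X, hT, hc, h1, h2, h3, h4, -, hiv⟩ :=
    H (κ / Real.sqrt 2) (div_pos hκ hs2) (by rw [div_mul_cancel₀ κ hs2.ne'])
  exact ⟨κ / Real.sqrt 2, T, c, X, div_pos hκ hs2, hT, hc, h1, h2, h3, h4, hiv⟩

end BlowupRigidityOne

end Summit.NavierStokesRegularity.NavierStokesRegularity.Theorems

end
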